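import Literature.NumberTheory.GaloisRepresentations.LocalBrauerRestrictionDegree
import Literature.NumberTheory.GaloisRepresentations.LocalGaloisGroupProofs
import Literature.NumberTheory.EllipticCurves.IwasawaCyclotomicProofs
import Mathlib.RingTheory.Polynomial.Cyclotomic.Roots
import Mathlib.RingTheory.Polynomial.Cyclotomic.Eval
import HarnessLib

/-!
# The `p`-adic cyclotomic character of a `p`-adic field has infinite image (Serre, *Corps locaux* IV §4)

Topic `NumberTheory/GaloisRepresentations`; namespace `Literature.NumberTheory.GaloisRepresentations`.
Theorems only (no definition, no named fact; D-0026).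

Let `F` be a non-archimedean local field of characteristic `0` whose residue characteristic is the
prime `p` (`|p|_F < 1`), `Γ_F = Gal(F̄/F)` and `χ_p : Γ_F → ℤ_pˣ` the `p`-adic cyclotomic character.

* `totient_le_of_isPrimitiveRoot_mem` — **if a finite `L/F` inside `F̄` contains a primitive
  `p^n`-th root of unity `ζ` (`n ≥ 1`), then `φ(p^n) ≤ [L : F] · ord_F(p)`**: in `L`,
  `p = Φ_{p^n}(1) = ∏ (1 - μ)` over the `φ(p^n)` primitive `p^n`-th roots of unity `μ`, each `1 - μ`
  lies in the maximal ideal of the valuation ring `O_L` (`μ^{p^n} = 1` and the residue field has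
  characteristic `p`), so `ord_F N_{L/F}(1 - μ) = f_L v_L(1 - μ) ≥ 1`, while
  `ord_F N_{L/F}(p) = [L : F] ord_F(p)`.  (Serre, *Corps locaux* IV §4 Prop. 17: `ℚ_p(ζ_{p^n})/ℚ_p`
  is totally ramified of degree `φ(p^n)`, `1 - ζ` a uniformiser; Neukirch II (7.13).)
* `cyclotomicCharacter_range_infinite_of_valuation_lt_one` — **`χ_p(Γ_F)` is infinite**, i.e.
  `F(μ_{p^∞})/F` is an infinite extension: otherwise `ker χ_p` is a closed subgroup of finite index,
  its fixed field `L` is finite over `F` (Krull) and contains all the `p`-power roots of unity of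
  `F̄`, contradicting the bound.  (The number-field analogue is the tree's
  `GaloisRep.cyclotomicCharacter_range_infinite`.)
* `exists_cyclotomicCharacter_not_mem_torsion` — **some `χ_p(σ)` has infinite order** (the torsion
  of `ℤ_pˣ` is finite, `PadicInt.finite_torsion_units`); equivalently `Γ_F` is not contained in
  `χ_p⁻¹(μ(ℤ_p))`, the kernel of the cyclotomic `ℤ_p`-extension: **no place above `p` splits
  completely in the cyclotomic `ℤ_p`-extension** (Greenberg, LNM 1716, §1; Washington §13.1).

## References
* J.-P. Serre, *Corps locaux*, Hermann, 1968, IV §4 Prop. 17; II §2 Cor. 3 to Prop. 3. [SerreLocalFields1979]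
* J. Neukirch, *Algebraic Number Theory* (1999), Ch. II Prop. (7.13). [NeukirchANT1999]
* R. Greenberg, *Iwasawa theory for elliptic curves*, LNM 1716 (1999), §1. [GreenbergLNM1716]
-/

noncomputable section

open Function Polynomial
open Field IsNonarchimedeanLocalField ValuativeRel IntermediateField

universe u

namespace Literature.NumberTheory.GaloisRepresentations

open LocalWeilDatum GaloisRepresentations.IsNonarchimedeanLocalField

section Local

variable (F : Type u) [Field F] [ValuativeRel F] [TopologicalSpace F] [IsNonarchimedeanLocalField F]
  [CharZero F] {p : ℕ} [hp : Fact p.Prime]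

/-! ### `t_L` of a product -/

omit [CharZero F] in
/-- `t_L(∏ aᵢ) = ∑ t_L(aᵢ)` for non-zero `aᵢ`. [folklore] -/
private theorem tVal_prod (L : IntermediateField F (AlgebraicClosure F)) [FiniteDimensional F L]
    {ι : Type*} (s : Finset ι) (f : ι → L) (hf : ∀ i ∈ s, f i ≠ 0) :
    tVal F L (∏ i ∈ s, f i) = ∑ i ∈ s, tVal F L (f i) := by
  classical
  induction s using Finset.induction_on with
  | empty => rw [Finset.prod_empty, Finset.sum_empty, tVal_one]
  | insert i s hi ih =>
    have hfi : f i ≠ 0 := hf i (Finset.mem_insert_self i s)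
    have hfs : ∀ j ∈ s, f j ≠ 0 := fun j hj => hf j (Finset.mem_insert_of_mem hj)
    rw [Finset.prod_insert hi, Finset.sum_insert hi,
      tVal_mul F L hfi (Finset.prod_ne_zero_iff.2 hfs), ih hfs]

/-! ### `1 - μ` lies in the maximal ideal for a `p`-power root of unity `μ` -/

/-- **`t_L(1 - μ) ≥ 1` for a `p`-power root of unity `μ ≠ 1` of a finite `L/F`, `p` the residue
characteristic** (`|p|_F < 1`): `1 - μ` lies in the maximal ideal of the discrete valuation ring
`O_L` (Frobenius is injective modulo the radical ideal `𝔪_L ∋ p`: `(1 - μ)^{p^n} ≡ 1 - μ^{p^n} = 0`),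
so `1 - μ = v π^k` with `k ≥ 1` and `ord_F N_{L/F}(1 - μ) = f_L k ≥ 1`.
[cite: SerreLocalFields1979, II §2 Cor. 3 to Prop. 3; IV §4 Prop. 17 (proof)] -/
theorem one_le_tVal_one_sub_of_pow_prime_pow_eq_one (hpv : valuation F (p : F) < 1)
    (L : IntermediateField F (AlgebraicClosure F)) [FiniteDimensional F L]
    {μ : L} {n : ℕ} (hμ : μ ^ p ^ n = 1) (hμ1 : μ ≠ 1) : 1 ≤ tVal F L (1 - μ) := by
  classical
  have hLs : L ≤ sepClosure F := le_sepClosure_of_charZero F L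
  haveI := isDiscreteValuationRing_integralClosure' F L hLs
  set O := integralClosure 𝒪[F] L with hOdef
  obtain ⟨π, hπ⟩ := IsDiscreteValuationRing.exists_irreducible O
  -- `μ` and `1 - μ` are integral
  have hμint : IsIntegral 𝒪[F] μ :=
    IsIntegral.of_pow (pow_pos hp.out.pos n) (by rw [hμ]; exact isIntegral_one)
  have hμO : μ ∈ O := (mem_integralClosure_iff _ _).2 hμint
  have haO : 1 - μ ∈ O := Subalgebra.sub_mem O (Subalgebra.one_mem O) hμO
  set a : O := ⟨1 - μ, haO⟩ with hadef
  have ha0 : a ≠ 0 := fun h => hμ1 (by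
    have h' : (1 : L) - μ = 0 := congrArg Subtype.val h
    exact (sub_eq_zero.1 h').symm)
  -- `p ∈ 𝔪_L`
  have hpm : ((p : ℕ) : 𝒪[F]) ∈ 𝓂[F] := by
    rw [mem_maximalIdeal_iff_valuation_lt_one]
    exact_mod_cast hpv
  have hpabs : ((p : ℕ) : absIntegers 𝒪[F] F) ∈ absMaximalIdeal F := by
    have h' := Ideal.mem_map_of_mem (algebraMap 𝒪[F] (absIntegers 𝒪[F] F)) hpm
    rw [map_natCast] at h'
    exact Ideal.le_radical h'
  have hpO : ((p : ℕ) : O) ∈ IsLocalRing.maximalIdeal O := by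
    rw [maximalIdeal_eq_primeOf F L, Ideal.mem_comap, map_natCast]
    exact hpabs
  -- `1 - μ ∈ 𝔪_L` by injectivity of Frobenius modulo `𝔪_L`
  have hrad : (IsLocalRing.maximalIdeal O).IsRadical :=
    (IsLocalRing.maximalIdeal.isMaximal O).isPrime.isRadical
  have hμO' : (⟨μ, hμO⟩ : O) ^ p ^ n = 1 := Subtype.ext (by
    rw [SubmonoidClass.coe_pow, OneMemClass.coe_one]; exact hμ)
  have hamem : a ∈ IsLocalRing.maximalIdeal O := by
    have h := IsFrobPow.sub_mem_of_pow_prime_pow_sub_pow_mem hp.out hrad hpO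
      (u := (1 : O)) (v := ⟨μ, hμO⟩) (n := n) (by rw [one_pow, hμO', sub_self]; exact zero_mem _)
    have hav : a = 1 - ⟨μ, hμO⟩ := Subtype.ext rfl
    rw [hav]
    exact h
  -- `a = v π^k` with `k ≥ 1`
  obtain ⟨k, v, hk⟩ := IsDiscreteValuationRing.eq_unit_mul_pow_irreducible ha0 hπ
  have hk0 : k ≠ 0 := by
    rintro rfl
    rw [pow_zero, mul_one] at hk
    rw [hk] at hamem
    exact (IsLocalRing.mem_maximalIdeal _).1 hamem v.isUnit
  have hord := ord_norm_eq_of_eq_unit_mul_pow F L hLs hπ hk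
  have hf : 0 < Ideal.inertiaDeg' 𝓂[F] (primeOf F L) := fDeg_pos F L
  change 1 ≤ LocalWeilDatum.ord F (Algebra.norm F ((a : O) : L))
  rw [hord]
  have : (1 : ℤ) ≤ (Ideal.inertiaDeg' 𝓂[F] (primeOf F L) : ℤ) * k := by
    have h1 : 1 ≤ k := Nat.one_le_iff_ne_zero.2 hk0
    nlinarith
  exact_mod_cast this

/-! ### The degree bound `φ(p^n) ≤ [L : F] ord_F(p)` -/

/-- **`φ(p^n) ≤ [L : F] · ord_F(p)` if the finite `L/F` contains a primitive `p^n`-th root of unity**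
(`n ≥ 1`, `p` the residue characteristic): `p = Φ_{p^n}(1) = ∏_μ (1 - μ)` over the `φ(p^n)`
primitive `p^n`-th roots of unity of `L` (`cyclotomic_eq_prod_X_sub_primitiveRoots`,
`eval_one_cyclotomic_prime_pow`), `t_L(1 - μ) ≥ 1` for each
(`one_le_tVal_one_sub_of_pow_prime_pow_eq_one`) and `t_L(p) = ord_F(p^{[L:F]}) = [L : F] ord_F(p)`.
[cite: SerreLocalFields1979, IV §4 Prop. 17] [cite: NeukirchANT1999, Ch. II Prop. (7.13)] -/
theorem totient_le_of_isPrimitiveRoot_mem (hpv : valuation F (p : F) < 1)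
    (L : IntermediateField F (AlgebraicClosure F)) [FiniteDimensional F L] {n : ℕ} (hn : 0 < n)
    {ζ : AlgebraicClosure F} (hζ : IsPrimitiveRoot ζ (p ^ n)) (hζL : ζ ∈ L) :
    (((p ^ n).totient : ℕ) : ℤ) ≤ Module.finrank F L * LocalWeilDatum.ord F (p : F) := by
  classical
  set ζ' : L := ⟨ζ, hζL⟩ with hζ'def
  have hζ' : IsPrimitiveRoot ζ' (p ^ n) := IsPrimitiveRoot.coe_submonoidClass_iff.mp (by exact hζ)
  obtain ⟨m, rfl⟩ : ∃ m, n = m + 1 := ⟨n - 1, (Nat.sub_add_cancel hn).symm⟩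
  -- `p = ∏ (1 - μ)` in `L`
  have hprod : (p : L) = ∏ μ ∈ primitiveRoots (p ^ (m + 1)) L, (1 - μ) := by
    have h1 := eval_one_cyclotomic_prime_pow (R := L) (p := p) m
    rw [cyclotomic_eq_prod_X_sub_primitiveRoots hζ', eval_prod] at h1
    simp only [eval_sub, eval_X, eval_C] at h1
    exact h1.symm
  have hp1 : 1 < p ^ (m + 1) := Nat.one_lt_pow (Nat.succ_ne_zero m) hp.out.one_lt
  have hfac : ∀ μ ∈ primitiveRoots (p ^ (m + 1)) L, (1 : L) - μ ≠ 0 ∧ 1 ≤ tVal F L (1 - μ) := by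
    intro μ hμ
    have hμ' : IsPrimitiveRoot μ (p ^ (m + 1)) := (mem_primitiveRoots (pow_pos hp.out.pos _)).1 hμ
    have hμ1 : μ ≠ 1 := hμ'.ne_one hp1
    exact ⟨fun h => hμ1 (sub_eq_zero.1 h).symm,
      one_le_tVal_one_sub_of_pow_prime_pow_eq_one F hpv L hμ'.pow_eq_one hμ1⟩
  -- `t_L(p) = ∑ t_L(1 - μ) ≥ φ(p^n)`
  have hsum : tVal F L (p : L) = ∑ μ ∈ primitiveRoots (p ^ (m + 1)) L, tVal F L (1 - μ) := by
    rw [hprod]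
    exact tVal_prod F L _ _ fun μ hμ => (hfac μ hμ).1
  have hge : (((p ^ (m + 1)).totient : ℕ) : ℤ) ≤ tVal F L (p : L) := by
    rw [hsum, ← hζ'.card_primitiveRoots]
    have h := Finset.card_nsmul_le_sum (primitiveRoots (p ^ (m + 1)) L) (fun μ => tVal F L (1 - μ)) 1
      fun μ hμ => (hfac μ hμ).2
    rwa [nsmul_eq_mul, mul_one] at h
  -- `t_L(p) = [L : F] ord_F(p)`
  have hp0 : (p : F) ≠ 0 := Nat.cast_ne_zero.2 hp.out.ne_zero
  have htp : tVal F L (p : L) = Module.finrank F L * LocalWeilDatum.ord F (p : F) := by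
    unfold tVal
    rw [show (p : L) = algebraMap F L p from (map_natCast (algebraMap F L) p).symm,
      Algebra.norm_algebraMap, LocalWeilDatum.ord_pow F hp0]
  rw [← htp]
  exact hge

/-! ### `χ_p(Γ_F)` is infinite -/

/-- **Over a `p`-adic field the `p`-adic cyclotomic character has infinite image**, i.e.
`F(μ_{p^∞})/F` is an infinite extension (`F` non-archimedean local of characteristic `0` with
residue characteristic `p`).  Proof: otherwise `ker χ_p ≤ Γ_F` is a closed subgroup of finite index,
whose fixed field `L ⊆ F̄` is a finite extension of `F` (Krull correspondence,
`InfiniteGalois.fixingSubgroup_fixedField`, `IntermediateField.finrank_eq_fixingSubgroup_index`) of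
degree `d`; every `σ ∈ ker χ_p` fixes the `p`-power roots of unity of `F̄`
(`GaloisRep.cyclotomicCharacter_spec`), so `L` contains a primitive `p^{e+1}`-th root of unity for
`e = d ord_F(p)`, and `φ(p^{e+1}) = p^e (p - 1) > e ≥ [L : F] ord_F(p)` contradicts
`totient_le_of_isPrimitiveRoot_mem`.  (Number-field analogue: the tree's
`GaloisRep.cyclotomicCharacter_range_infinite`.)
[cite: SerreLocalFields1979, IV §4 Prop. 17] [cite: NeukirchANT1999, Ch. II Prop. (7.13)] -/
theorem cyclotomicCharacter_range_infinite_of_valuation_lt_one (hpv : valuation F (p : F) < 1) :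
    (Set.range (GaloisRep.cyclotomicCharacter F p)).Infinite := by
  classical
  intro hfin
  set χ := GaloisRep.cyclotomicCharacter F p with hχ
  -- the kernel of `χ`: a closed subgroup of finite index
  set H : Subgroup (absoluteGaloisGroup F) := χ.toMonoidHom.ker with hH
  have hHclosed : IsClosed (H : Set (absoluteGaloisGroup F)) := by
    have : IsClosed ({1} : Set ℤ_[p]ˣ) := isClosed_singleton
    exact this.preimage χ.continuous
  set H' : Subgroup (AlgebraicClosure F ≃ₐ[F] AlgebraicClosure F) :=
    H.map (absoluteGaloisGroup.toAlgEquiv F).toMonoidHom with hH'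
  have hH'closed : IsClosed (H' : Set (AlgebraicClosure F ≃ₐ[F] AlgebraicClosure F)) := by
    have hHeq : (H' : Set (AlgebraicClosure F ≃ₐ[F] AlgebraicClosure F)) =
        (absoluteGaloisGroup.toAlgEquiv F).symm ⁻¹' H := by
      rw [hH', Subgroup.coe_map]
      exact (absoluteGaloisGroup.toAlgEquiv F).toEquiv.image_eq_preimage_symm _
    rw [hHeq]
    exact hHclosed.preimage continuous_id
  -- its fixed field `L`, a finite extension of `F`
  set L := IntermediateField.fixedField H' with hL
  have hfix : L.fixingSubgroup = H' := InfiniteGalois.fixingSubgroup_fixedField ⟨H', hH'closed⟩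
  have hcard : Nat.card χ.toMonoidHom.range = Nat.card (Set.range χ) := rfl
  have hindex : Module.finrank F L = Nat.card (Set.range χ) := by
    rw [IntermediateField.finrank_eq_fixingSubgroup_index, hfix, hH',
      Subgroup.index_map_of_bijective (absoluteGaloisGroup.toAlgEquiv F).bijective, hH,
      Subgroup.index_ker, hcard]
  haveI : Finite (Set.range χ) := hfin.to_subtype
  haveI : Nonempty (Set.range χ) := ⟨⟨χ 1, 1, rfl⟩⟩
  have hpos : 0 < Module.finrank F L := by rw [hindex]; exact Nat.card_pos
  haveI : FiniteDimensional F L := Module.finite_of_finrank_pos hpos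
  set e := (Module.finrank F L * LocalWeilDatum.ord F (p : F)).toNat with he
  -- a primitive `p^(e+1)`-th root of unity of `F̄` lies in `L`
  haveI : NeZero ((p ^ (e + 1) : ℕ) : AlgebraicClosure F) :=
    ⟨by exact_mod_cast pow_ne_zero _ hp.out.ne_zero⟩
  obtain ⟨ζ, hζ⟩ := HasEnoughRootsOfUnity.exists_primitiveRoot (AlgebraicClosure F) (p ^ (e + 1))
  have hζL : ζ ∈ L := by
    rw [hL, IntermediateField.mem_fixedField_iff]
    rintro f ⟨σ, hσ, rfl⟩
    rw [SetLike.mem_coe, hH, MonoidHom.mem_ker] at hσ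
    change (absoluteGaloisGroup.toAlgEquiv F σ) ζ = ζ
    haveI : NeZero (p : F) := NeZero.charZero
    haveI : Fact (1 < p ^ (e + 1)) := ⟨Nat.one_lt_pow (Nat.succ_ne_zero e) hp.out.one_lt⟩
    rw [← absoluteGaloisGroup.smul_def, GaloisRep.cyclotomicCharacter_spec F p σ ζ hζ.pow_eq_one]
    rw [show GaloisRep.cyclotomicCharacter F p σ = 1 from hσ, Units.val_one, map_one, ZMod.val_one,
      pow_one]
  -- degree count: `φ(p^(e+1)) ≤ [L : F] ord_F(p) ≤ e`
  have h1 := totient_le_of_isPrimitiveRoot_mem F hpv L (Nat.succ_pos e) hζ hζL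
  rw [Nat.totient_prime_pow hp.out (Nat.succ_pos e), Nat.succ_sub_one] at h1
  have h2 : e < p ^ e * (p - 1) :=
    calc e < 2 ^ e := Nat.lt_two_pow_self
      _ ≤ p ^ e := Nat.pow_le_pow_left hp.out.two_le e
      _ ≤ p ^ e * (p - 1) := Nat.le_mul_of_pos_right _ (by have := hp.out.two_le; omega)
  have h3 : Module.finrank F L * LocalWeilDatum.ord F (p : F) ≤ (e : ℤ) := by rw [he]; exact Int.self_le_toNat _
  have h4 : ((p ^ e * (p - 1) : ℕ) : ℤ) ≤ (e : ℤ) := h1.trans h3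
  exact absurd (by exact_mod_cast h4 : p ^ e * (p - 1) ≤ e) (not_le.2 h2)

/-- **Some value of the `p`-adic cyclotomic character of a `p`-adic field has infinite order**:
`∃ σ ∈ Γ_F, χ_p(σ) ∉ (ℤ_pˣ)_{tors}` (the torsion of `ℤ_pˣ` is finite, `PadicInt.finite_torsion_units`,
and `χ_p(Γ_F)` is infinite).  Equivalently `Γ_F ⊄ χ_p⁻¹(μ(ℤ_p))`: **no prime above `p` splits
completely in the cyclotomic `ℤ_p`-extension** (Greenberg, LNM 1716 §1: `Gal((F_∞)_η/F_v) ≅ ℤ_p`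
"for every nonarchimedean `v`").
[cite: SerreLocalFields1979, IV §4 Prop. 17] [cite: GreenbergLNM1716, §1] -/
theorem exists_cyclotomicCharacter_not_mem_torsion (hpv : valuation F (p : F) < 1) :
    ∃ σ : absoluteGaloisGroup F, GaloisRep.cyclotomicCharacter F p σ ∉ CommGroup.torsion ℤ_[p]ˣ := by
  by_contra h
  simp only [not_exists, not_not] at h
  have hsub : Set.range (GaloisRep.cyclotomicCharacter F p) ⊆ (CommGroup.torsion ℤ_[p]ˣ : Set ℤ_[p]ˣ) := by
    rintro _ ⟨σ, rfl⟩
    exact h σ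
  exact cyclotomicCharacter_range_infinite_of_valuation_lt_one F hpv
    ((Literature.NumberTheory.EllipticCurves.PadicInt.finite_torsion_units (p := p)).subset hsub)

end Local

end Literature.NumberTheory.GaloisRepresentations

end
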